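import Summits.BirchSwinnertonDyer.Rank1Residual.Ordinary.StrictSelmerIndexRankOne
import Summits.BirchSwinnertonDyer.Rank1Residual.Ordinary.LocalPointsModTorsionCyclic
import Literature.NumberTheory.EllipticCurves.LocalKummerIsotropyTransport
import HarnessLib

/-!
# THE STRICT `p`-SELMER COUNT OVER `ℚ` IN RANK ONE, UNCONDITIONAL: `#Sel_0(ℚ, E[p^∞]) = p^(m_p) · #Ш(E/ℚ)[p^∞]`
# (theorems only — no definition, no named fact; nothing asserted about any curve's BSD; C-16 stays a CONJECTURE)

HONEST FRAMING (cell `b2b-bsdres`, run/shared/lean/b2b/bsd-rank1-residual/, verbatim in every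
file): the goal of the cell is to DELETE the COMBINATION-SHAPED residual classes of the
Birch–Swinnerton-Dyer formula for ALL analytic-rank `≤ 1` elliptic curves over `ℚ` — "full BSD
formula for every rank `≤ 1` curve in class `C`" assembled STRICTLY from published theorems — so
that the rank-`≤ 1` remainder becomes exactly the CONSTRUCTION-SHAPED classes, which are TYPED
(missing-input `Prop`s), NOT attempted. This is not "finishing BSD". Seat `b2b-bsdres-additive-p3`
(X8 prover B / X7 joint; typer-designate for the cell conjecture C-16 = hyp C120.1 by hyp R-16 (e)).
This file books nothing and moves no mark; X7 / X8 stay CONSTRUCTION-SHAPED.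

## What this file does

`Ordinary/StrictSelmerIndexRankOne.lean` proved `#Sel_0 = p^m · #Ш[p^∞]` at a completion modulo ONE local
hypothesis `hL` (the kernel of `H¹(K_v, E[p^∞]) → H¹(K_v, E)` has at most `p` elements killed by `p`), and
`Ordinary/LocalPointsModTorsionCyclic.lean` proved that `E(ℚ_v)` is cyclic modulo `p` and torsion (AEC VII.6.3).
This file joins them:
* §1 (`exists_eq_kummerMapLevel_one`, `kummerMapLevel_one_eq_smul`; any perfect field `F`): the
  `p`-torsion of `im κ ⊆ H¹(F, E[p^∞])` consists of level-one Kummer classes `κ_1(X₀)`, and when `E(F)` is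
  cyclic modulo `p` and torsion these lie on the line `ℤ/p · κ_1(Y)`;
* §2 `local_card_le_of_cyclic`: **`hL` holds at any perfect `K`-field `E` with `E(E)` cyclic modulo `p` and
  torsion** — transport `H¹(Γ_E, (W⁄E)[p^∞](Ē)) ≅ H¹(Γ_E, E(K̄_E)[p^∞])` along the tree's equivariant
  `baseChangeGeomPointsEquiv` (`LocalKummerIsotropyTransport`), then the Kummer theory of `W⁄E` over the
  field `E` (`range_kummerMapPInfty`) and §1 (Kim 2022 Lemma 5.1 «`H¹_{/f}(ℚ_p, T)` free of rank one» in
  group form);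
* §3 **`natCard_strictSelmer_rat_eq`**: for `E/ℚ`, a prime `p`, the place `v ∋ p`, `P₁` of infinite order
  generating `E(ℚ)` modulo torsion and `m = m_p(P₁)` (`P₁ ∈ p^m E(ℚ_v) + tors`, `∉ p^(m+1) E(ℚ_v) + tors`):
  `#(Sel_{p^∞}(E/ℚ) ∩ ker (H¹(ℚ, E[p^∞]) → H¹(ℚ_v, E[p^∞]))) = p^m · #Ш(E/ℚ)[p^∞]` (as `Nat.card`; so
  `Sel_0` is finite iff `Ш[p^∞]` is, and then `length Sel_0 = m_p + length Ш[p^∞]` — R1-DEPTH-LAW §2 (i),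
  the arithmetic half of the Mazur–Rubin Thm 5.2.12 step of C-16's derivation; the cohomological half
  `∂⁰(κ) − ∂^∞(κ) = length Sel_0` stays the named missing input); `exists_generator_natCard_strictSelmer_rat_eq`
  (rank-one form from `rank_ℤ E(ℚ) = 1`), `natCard_strictSelmer_adicCompletion_eq_of_cyclic` (any number
  field, at a place where `E(K_v)` is cyclic modulo `p` and torsion).

References: C.-H. Kim, Amer. J. Math. = arXiv:2203.12159, §5.1 eq. (5.1), Lemma 5.1 [Kim2022StructureSelmer];
B. Mazur, K. Rubin, Mem. AMS 799 (2004), Thm 5.2.12 [MazurRubin2004]; R. Greenberg, LNM 1716 (1999), §2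
[Greenberg1999LNM]; J. H. Silverman, AEC 2nd ed. (2009), VII.6.3, VIII.§2, X.§4 [SilvermanAEC2009];
`R1-DEPTH-LAW.md` §2 (i); `C16-KERNEL-DIGEST.md` §4.
-/

noncomputable section

open scoped Classical
open scoped AddSubgroup

open WeierstrassCurve Literature.NumberTheory.EllipticCurves
  Literature.NumberTheory.GaloisRepresentations

universe u

namespace Summit.BirchSwinnertonDyer.Rank1Residual.Ordinary

/-! ### §1 Level-one Kummer classes: the `p`-torsion of `im κ` -/

section LevelOne

variable {F : Type u} [Field F] [PerfectField F] (V : WeierstrassCurve F) [V.IsElliptic]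
variable (p : ℕ) [hp : Fact p.Prime]

/-- **The `p`-torsion of `im κ` consists of level-one Kummer classes**: if `y ∈ ker (H¹(F,E[p^∞]) → H¹(F,E))`
and `p • y = 0` then `y = κ_1(X₀)` for some `X₀ ∈ E(F)` (`y = κ_N(X)`, `κ_{N-1}(X) = p • y = 0`, so
`p^k X = p^{N-1+k} X₀` by the injectivity half of Kummer theory, and `κ_N(X) = κ_1(X₀)`).
Greenberg 1999 §2; Silverman AEC VIII.§2. [folklore] -/
theorem exists_eq_kummerMapLevel_one {y : galH1Primary V p} (hy : y ∈ (primaryH1ToH1 V p).ker)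
    (hpy : p • y = 0) : ∃ X₀ : V.toAffine.Point, y = kummerMapLevel V p V.zsmul_geomPoints_surjective_holds 1 X₀ := by
  rw [← range_kummerMapPInfty V p V.zsmul_geomPoints_surjective_holds] at hy
  obtain ⟨t, rfl⟩ := hy
  obtain ⟨X, N, rfl⟩ := exists_eq_tmul_prufGen V p t
  rw [kummerMapPInfty_tmul_prufGen] at hpy ⊢
  cases N with
  | zero => exact ⟨0, by rw [kummerMapLevel_zero_level, map_zero]⟩
  | succ N' =>
    have h0 : kummerMapLevel V p V.zsmul_geomPoints_surjective_holds N' X = 0 := by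
      rw [← kummerMapLevel_level V p V.zsmul_geomPoints_surjective_holds N' 1 (N' + 1) rfl X, pow_one, map_nsmul]
      exact hpy
    obtain ⟨k, X₀, hk⟩ := exists_of_kummerMapLevel_eq_zero V p V.zsmul_geomPoints_surjective_holds N' X h0
    refine ⟨X₀, ?_⟩
    rw [← kummerMapLevel_level V p V.zsmul_geomPoints_surjective_holds (N' + 1) k (N' + 1 + k) rfl X, hk,
      kummerMapLevel_level V p V.zsmul_geomPoints_surjective_holds 1 (N' + k) (N' + 1 + k) (by omega) X₀]

omit [PerfectField F] in
/-- **Cyclic modulo `p` and torsion ⟹ level-one Kummer classes lie on one line**: if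
`X = c • Y + p • Z + T` (`T` torsion) then `κ_1(X) = c' • κ_1(Y)` with `c' < p`
(`κ_1(p • Z) = 0`, `κ_1(T) = 0`, `p • κ_1(Y) = 0`). [folklore] -/
theorem kummerMapLevel_one_eq_smul {Y X : V.toAffine.Point}
    (hX : ∃ (c : ℕ) (Z T : V.toAffine.Point), IsOfFinAddOrder T ∧ X = c • Y + p • Z + T) :
    ∃ c < p, kummerMapLevel V p V.zsmul_geomPoints_surjective_holds 1 X = c • kummerMapLevel V p V.zsmul_geomPoints_surjective_holds 1 Y := by
  obtain ⟨c, Z, T, hT, rfl⟩ := hX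
  have hpY : p • kummerMapLevel V p V.zsmul_geomPoints_surjective_holds 1 Y = 0 := by
    rw [← map_nsmul, show p • Y = p ^ 1 • Y by rw [pow_one], kummerMapLevel_nsmul_self]
  refine ⟨c % p, Nat.mod_lt c hp.out.pos, ?_⟩
  rw [map_add, map_add, kummerMapLevel_eq_zero_of_isOfFinAddOrder V p V.zsmul_geomPoints_surjective_holds 1 hT, add_zero, map_nsmul,
    show p • Z = p ^ 1 • Z by rw [pow_one], kummerMapLevel_nsmul_self, add_zero]
  conv_lhs => rw [← Nat.div_add_mod c p, add_smul, mul_comm, mul_smul, hpY, smul_zero, zero_add]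

end LevelOne

/-! ### §2 The local hypothesis `hL` from «`E(E)` cyclic modulo `p` and torsion» -/

section Local

variable {K : Type u} [Field K] (W : WeierstrassCurve K) [W.IsElliptic]
variable (p : ℕ) [hp : Fact p.Prime]
variable (E : Type u) [Field E] [Algebra K E] [PerfectField E]

/-- **The local Kummer part of `H¹(E, E(K̄_E)[p^∞])` has at most `p` elements killed by `p` when
`E(E)` is cyclic modulo `p` and torsion** — the hypothesis `hL` of
`Ordinary/StrictSelmerIndexRankOne.forall_exists_sub_kummerPruferHom_mem`, discharged from
«`∃ Y, ∀ X ∈ E(E), X = c • Y + p • Z + T`» (for `E = ℚ_p`: `Ordinary/LocalPointsModTorsionCyclic`). Proof: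
transport `H¹(Γ_E, (W⁄E)[p^∞](Ē)) ≅ H¹(Γ_E, E(K̄_E)[p^∞])` along the tree's equivariant
`baseChangeGeomPointsEquiv`; an element of the kernel `L_E` killed by `p` pulls back to a `p`-torsion
element of `im κ_{W⁄E}` (`range_kummerMapPInfty` over the field `E`), i.e. a level-one class
`κ_1(X₀)` (§1), which is `c • κ_1(Y)` with `c < p`. Kim 2022 Lemma 5.1 («`H¹_{/f}(ℚ_p,T)` free of rank
one») in group form. [cite: Kim2022StructureSelmer, §5.1 Lemma 5.1] -/
theorem local_card_le_of_cyclic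
    (hLS : ∃ Y : (W.baseChange E).toAffine.Point, ∀ X : (W.baseChange E).toAffine.Point,
      ∃ (c : ℕ) (Z T : (W.baseChange E).toAffine.Point), IsOfFinAddOrder T ∧ X = c • Y + p • Z + T) :
    ∀ S : Finset (discreteH1 (Field.absoluteGaloisGroup E)
        (AddCommGroup.primaryComponent (localPoints W E) p)),
      (∀ y ∈ S, y ∈ resKer (ContinuousMonoidHom.id (Field.absoluteGaloisGroup E))
          (AddCommGroup.primaryComponent (localPoints W E) p).subtype (fun _ _ => rfl) ∧ p • y = 0) →
        S.card ≤ p := by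
  obtain ⟨Y, hY⟩ := hLS
  -- the equivariant identification `(W⁄E)(Ē) ≅ E(K̄_E)` on `p`-primary parts, both directions
  let e : geomPoints (W.baseChange E) ≃+ localPoints W E := W.baseChangeGeomPointsEquiv E
  let ep : geomPrimaryTorsion (W.baseChange E) p →+
      AddCommGroup.primaryComponent (localPoints W E) p :=
    (e.toAddMonoidHom.comp (geomPrimaryTorsion (W.baseChange E) p).subtype).codRestrict
      (AddCommGroup.primaryComponent (localPoints W E) p) fun P => by
        obtain ⟨k, hk⟩ := (AddCommGroup.mem_primaryComponent).mp P.2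
        refine (AddCommGroup.mem_primaryComponent).mpr ⟨k, ?_⟩
        change p ^ k • e (P : geomPoints (W.baseChange E)) = 0
        rw [← map_nsmul e, hk, map_zero]
  let ep' : AddCommGroup.primaryComponent (localPoints W E) p →+
      geomPrimaryTorsion (W.baseChange E) p :=
    (e.symm.toAddMonoidHom.comp (AddCommGroup.primaryComponent (localPoints W E) p).subtype).codRestrict
      (geomPrimaryTorsion (W.baseChange E) p) fun P => by
        obtain ⟨k, hk⟩ := (AddCommGroup.mem_primaryComponent).mp P.2
        refine (AddCommGroup.mem_primaryComponent).mpr ⟨k, ?_⟩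
        change p ^ k • e.symm (P : localPoints W E) = 0
        rw [← map_nsmul e.symm, hk, map_zero]
  have hep : ∀ (σ : Field.absoluteGaloisGroup E) (P : geomPrimaryTorsion (W.baseChange E) p),
      ep ((ContinuousMonoidHom.id (Field.absoluteGaloisGroup E)) σ • P) = σ • ep P := fun σ P =>
    Subtype.ext (W.baseChangeGeomPointsEquiv_smul E σ (P : geomPoints (W.baseChange E)))
  have hep' : ∀ (σ : Field.absoluteGaloisGroup E)
      (P : AddCommGroup.primaryComponent (localPoints W E) p),
      ep' ((ContinuousMonoidHom.id (Field.absoluteGaloisGroup E)) σ • P) = σ • ep' P := fun σ P =>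
    Subtype.ext (W.baseChangeGeomPointsEquiv_symm_smul E σ (P : localPoints W E))
  let Φ := resH1Hom (ContinuousMonoidHom.id (Field.absoluteGaloisGroup E)) ep hep
  let Ψ := resH1Hom (ContinuousMonoidHom.id (Field.absoluteGaloisGroup E)) ep' hep'
  -- `Φ ∘ Ψ = id`
  have hΦΨ : ∀ y, Φ (Ψ y) = y := by
    intro y
    have hcomp : ep.comp ep' = AddMonoidHom.id _ := by
      ext P
      change e (e.symm (P : localPoints W E)) = P
      exact e.apply_symm_apply _
    have h := congrArg (fun f => f y)
      (resH1Hom_comp (ContinuousMonoidHom.id (Field.absoluteGaloisGroup E)) ep' hep'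
        (ContinuousMonoidHom.id (Field.absoluteGaloisGroup E)) ep hep)
    change Φ (Ψ y) = _ at h
    have hid : (ContinuousMonoidHom.id (Field.absoluteGaloisGroup E)).comp
        (ContinuousMonoidHom.id (Field.absoluteGaloisGroup E)) =
          ContinuousMonoidHom.id (Field.absoluteGaloisGroup E) := rfl
    rw [h, resH1Hom_congr hid hcomp _ (fun _ _ => rfl), resH1Hom_id, AddMonoidHom.id_apply]
  -- `Ψ` maps the kernel `L_E` into `ker (H¹(E, (W⁄E)[p^∞]) → H¹(E, W⁄E))`
  have hΨker : ∀ y, y ∈ resKer (ContinuousMonoidHom.id (Field.absoluteGaloisGroup E))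
      (AddCommGroup.primaryComponent (localPoints W E) p).subtype (fun _ _ => rfl) →
      Ψ y ∈ (primaryH1ToH1 (W.baseChange E) p).ker := by
    intro y hy
    rw [resKer_eq_ker, AddMonoidHom.mem_ker] at hy
    rw [AddMonoidHom.mem_ker]
    have hcomp : (geomPrimaryTorsion (W.baseChange E) p).subtype.comp ep' =
        e.symm.toAddMonoidHom.comp (AddCommGroup.primaryComponent (localPoints W E) p).subtype := by
      ext P; rfl
    have hesymm : ∀ (σ : Field.absoluteGaloisGroup E) (Q : localPoints W E),
        e.symm.toAddMonoidHom ((ContinuousMonoidHom.id (Field.absoluteGaloisGroup E)) σ • Q) =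
          σ • e.symm.toAddMonoidHom Q := fun σ Q =>
      W.baseChangeGeomPointsEquiv_symm_smul E σ Q
    have h := congrArg (fun f => f y)
      (resH1Hom_comp (ContinuousMonoidHom.id (Field.absoluteGaloisGroup E)) ep' hep'
        (ContinuousMonoidHom.id (Field.absoluteGaloisGroup E))
        (geomPrimaryTorsion (W.baseChange E) p).subtype (fun _ _ => rfl))
    change primaryH1ToH1 (W.baseChange E) p (Ψ y) = _ at h
    rw [h, resH1Hom_congr rfl hcomp _ (fun σ Q => hesymm σ (Q : localPoints W E)),
      ← resH1Hom_comp (ContinuousMonoidHom.id (Field.absoluteGaloisGroup E))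
        (AddCommGroup.primaryComponent (localPoints W E) p).subtype (fun _ _ => rfl)
        (ContinuousMonoidHom.id (Field.absoluteGaloisGroup E)) e.symm.toAddMonoidHom hesymm,
      AddMonoidHom.comp_apply, hy, map_zero]
  -- the line: every `y ∈ L_E` killed by `p` is `c • y₀`, `c < p`
  set y₀ := Φ (kummerMapLevel (W.baseChange E) p (W.baseChange E).zsmul_geomPoints_surjective_holds 1 Y) with hy₀
  have hline : ∀ y, y ∈ resKer (ContinuousMonoidHom.id (Field.absoluteGaloisGroup E))
      (AddCommGroup.primaryComponent (localPoints W E) p).subtype (fun _ _ => rfl) → p • y = 0 →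
      ∃ c < p, y = c • y₀ := by
    intro y hy hpy
    have hpy' : p • Ψ y = 0 := by rw [← map_nsmul, hpy, map_zero]
    obtain ⟨X₀, hX₀⟩ := exists_eq_kummerMapLevel_one (W.baseChange E) p (hΨker y hy) hpy'
    obtain ⟨c, hc, hcX⟩ := kummerMapLevel_one_eq_smul (W.baseChange E) p (hY X₀)
    refine ⟨c, hc, ?_⟩
    rw [← hΦΨ y, hX₀, hcX, map_nsmul]
  -- count
  intro S hS
  have hsub : S ⊆ (Finset.range p).image fun i => i • y₀ := by
    intro y hyS
    obtain ⟨c, hc, rfl⟩ := hline y (hS y hyS).1 (hS y hyS).2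
    exact Finset.mem_image.mpr ⟨c, Finset.mem_range.mpr hc, rfl⟩
  calc S.card ≤ ((Finset.range p).image fun i => i • y₀).card := Finset.card_le_card hsub
    _ ≤ (Finset.range p).card := Finset.card_image_le
    _ = p := Finset.card_range p

end Local

/-! ### §3 The strict-Selmer count at a completion where `E(K_v)` is cyclic modulo `p` and torsion; over `ℚ` -/

section Count

variable {K : Type u} [Field K] [NumberField K] (W : WeierstrassCurve K) [W.IsElliptic]
variable (p : ℕ) [hp : Fact p.Prime]

/-- **`#Sel_0 = p^m · #Ш(E/K)[p^∞]` at a finite place `v` where `E(K_v)` is cyclic modulo `p` and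
torsion** (`[K_v : ℚ_p] ≤ 1`-type places; the one remaining hypothesis is that group-theoretic fact).
[cite: Kim2022StructureSelmer, §5.1 eq. (5.1) and Lemma 5.1] -/
theorem natCard_strictSelmer_adicCompletion_eq_of_cyclic
    (v : IsDedekindDomain.HeightOneSpectrum (NumberField.RingOfIntegers K))
    (hLS : ∃ Y : (W.baseChange (v.adicCompletion K)).toAffine.Point,
      ∀ X : (W.baseChange (v.adicCompletion K)).toAffine.Point,
        ∃ (c : ℕ) (Z T : (W.baseChange (v.adicCompletion K)).toAffine.Point),
          IsOfFinAddOrder T ∧ X = c • Y + p • Z + T)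
    {P₁ : W.toAffine.Point} (hP₁ : ¬ IsOfFinAddOrder P₁)
    (hgen : ∀ P : W.toAffine.Point, ∃ (a : ℤ) (t : W.toAffine.Point),
      IsOfFinAddOrder t ∧ P = a • P₁ + t) {m : ℕ}
    (hm : ∃ R T : (W.baseChange (v.adicCompletion K)).toAffine.Point, IsOfFinAddOrder T ∧
      Affine.Point.baseChange (W' := W) K (v.adicCompletion K) P₁ = p ^ m • R + T)
    (hm1 : ¬ ∃ R T : (W.baseChange (v.adicCompletion K)).toAffine.Point, IsOfFinAddOrder T ∧
      Affine.Point.baseChange (W' := W) K (v.adicCompletion K) P₁ = p ^ (m + 1) • R + T) :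
    Nat.card ↥(W.selmerGroupPInfty p ⊓ selmerLocalKerPrimaryTorsion W (v.adicCompletion K) p) =
      p ^ m * Nat.card (AddCommGroup.primaryComponent W.sha p) := by
  haveI : CharZero (v.adicCompletion K) :=
    charZero_of_injective_algebraMap (algebraMap K (v.adicCompletion K)).injective
  haveI : PerfectField (v.adicCompletion K) := PerfectField.ofCharZero
  exact natCard_strictSelmer_adicCompletion_eq W p v hP₁ hgen hm hm1
    (local_card_le_of_cyclic W p (v.adicCompletion K) hLS)

/-- **THE STRICT `p`-SELMER COUNT OVER `ℚ` (unconditional): `#Sel_0(ℚ, E[p^∞]) = p^{m_p} · #Ш(E/ℚ)[p^∞]`.**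
For an elliptic curve `E/ℚ` (model `W`), a prime `p`, the place `v ∋ p` of `ℚ`, a point `P₁` of
infinite order generating `E(ℚ)` modulo torsion (rank one), and `m = m_p(P₁)` its local divisibility
level (`P₁ ∈ p^m E(ℚ_v) + tors`, `P₁ ∉ p^{m+1} E(ℚ_v) + tors`):
`#(Sel_{p^∞}(E/ℚ) ∩ ker (H¹(ℚ,E[p^∞]) → H¹(ℚ_v, E[p^∞]))) = p^m · #Ш(E/ℚ)[p^∞]` — both sides as `Nat.card`
(so `Sel_0` is finite iff `Ш[p^∞]` is, and then `length Sel_0 = m_p + length Ш[p^∞]`: R1-DEPTH-LAW §2 (i);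
the tree's `finite_strictSelmer_of_mordellWeilRank_eq_one` is the qualitative form). Inputs: the global
`p^∞` Kummer theory of the tree, `Sel_{p^∞} ↠ Ш[p^∞]`, and AEC VII.6.3 (`E(ℚ_p) ⊇ A ≅ ℤ_p`). Nothing
about BSD is asserted. [cite: Kim2022StructureSelmer, §5.1 eq. (5.1) and Lemma 5.1] -/
theorem natCard_strictSelmer_rat_eq [DecidableEq ℚ] (W : WeierstrassCurve ℚ) [W.IsElliptic] (p : ℕ)
    [Fact p.Prime] {v : IsDedekindDomain.HeightOneSpectrum (NumberField.RingOfIntegers ℚ)}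
    (hpv : (p : NumberField.RingOfIntegers ℚ) ∈ v.asIdeal)
    {P₁ : W.toAffine.Point} (hP₁ : ¬ IsOfFinAddOrder P₁)
    (hgen : ∀ P : W.toAffine.Point, ∃ (a : ℤ) (t : W.toAffine.Point),
      IsOfFinAddOrder t ∧ P = a • P₁ + t) {m : ℕ}
    (hm : ∃ R T : (W.baseChange (v.adicCompletion ℚ)).toAffine.Point, IsOfFinAddOrder T ∧
      Affine.Point.baseChange (W' := W) ℚ (v.adicCompletion ℚ) P₁ = p ^ m • R + T)
    (hm1 : ¬ ∃ R T : (W.baseChange (v.adicCompletion ℚ)).toAffine.Point, IsOfFinAddOrder T ∧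
      Affine.Point.baseChange (W' := W) ℚ (v.adicCompletion ℚ) P₁ = p ^ (m + 1) • R + T) :
    Nat.card ↥(W.selmerGroupPInfty p ⊓ selmerLocalKerPrimaryTorsion W (v.adicCompletion ℚ) p) =
      p ^ m * Nat.card (AddCommGroup.primaryComponent W.sha p) := by
  -- bridge the `DecidableEq ℚ` instance of the statement to the classical one of the general theorems
  obtain rfl : ‹DecidableEq ℚ› = fun a b ↦ Classical.propDecidable (a = b) := Subsingleton.elim _ _
  exact natCard_strictSelmer_adicCompletion_eq_of_cyclic W p v
    (exists_generator_mod_p_add_torsion_adicCompletion W hpv) hP₁ hgen hm hm1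

/-- **Rank-one form**: with `rank_ℤ E(ℚ) = 1` the Mordell–Weil generator `P₁` exists (tree
`exists_generator_of_mordellWeilRank_eq_one`), and for it `#Sel_0 = p^{m_p(P₁)} · #Ш[p^∞]`; here stated as:
there is a point `P₁` of infinite order generating modulo torsion such that for every `m` which is its local
divisibility level the count holds. [cite: Kim2022StructureSelmer, §5.1 eq. (5.1) and Lemma 5.1] -/
theorem exists_generator_natCard_strictSelmer_rat_eq [DecidableEq ℚ] (W : WeierstrassCurve ℚ) [W.IsElliptic]
    (p : ℕ) [Fact p.Prime] {v : IsDedekindDomain.HeightOneSpectrum (NumberField.RingOfIntegers ℚ)}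
    (hpv : (p : NumberField.RingOfIntegers ℚ) ∈ v.asIdeal) (hrank : W.mordellWeilRank = 1) :
    ∃ P₁ : W.toAffine.Point, ¬ IsOfFinAddOrder P₁ ∧
      (∀ P : W.toAffine.Point, ∃ (a : ℤ) (t : W.toAffine.Point), IsOfFinAddOrder t ∧ P = a • P₁ + t) ∧
      ∀ m : ℕ,
        (∃ R T : (W.baseChange (v.adicCompletion ℚ)).toAffine.Point, IsOfFinAddOrder T ∧
          Affine.Point.baseChange (W' := W) ℚ (v.adicCompletion ℚ) P₁ = p ^ m • R + T) →
        (¬ ∃ R T : (W.baseChange (v.adicCompletion ℚ)).toAffine.Point, IsOfFinAddOrder T ∧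
          Affine.Point.baseChange (W' := W) ℚ (v.adicCompletion ℚ) P₁ = p ^ (m + 1) • R + T) →
        Nat.card ↥(W.selmerGroupPInfty p ⊓ selmerLocalKerPrimaryTorsion W (v.adicCompletion ℚ) p) =
          p ^ m * Nat.card (AddCommGroup.primaryComponent W.sha p) := by
  obtain rfl : ‹DecidableEq ℚ› = fun a b ↦ Classical.propDecidable (a = b) := Subsingleton.elim _ _
  obtain ⟨P₁, hP₁, hgen⟩ := exists_generator_of_mordellWeilRank_eq_one W hrank
  exact ⟨P₁, hP₁, hgen, fun m hm hm1 => natCard_strictSelmer_adicCompletion_eq_of_cyclic W p v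
    (exists_generator_mod_p_add_torsion_adicCompletion W hpv) hP₁ hgen hm hm1⟩

end Count

end Summit.BirchSwinnertonDyer.Rank1Residual.Ordinary

end
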